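import Summits.CriticalPhenomena.SAWScalingLimit.Theorems.ConfinementPositivity.Negative.Cusp2Lattice

/-!
# `ConfinementPositivity` (stmt-CriticalPhenomena-17587) — negative knowledge, cusp series part 3: the bare corridor and the forced run

Refuter crux-attack support file (cdisprove).  Lattice combinatorics of the cusp witness at the
meshes `δ = 1/k²` (`k ≥ 5`), for the cusp `Ω' = {0 < x < 1, |y| < x²/16}` and the fat region
`Ω = {0 < x < 1, -1 < y < x²/16}` (both graph strips in the sense of `Cusp2Lattice`):

* `cusp_vec_mem_iff`, `fat_vec_mem_iff` — membership of a lattice site in integer arithmetic;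
* `cusp_offaxis_not_mem` — the columns `1 ≤ m ≤ 4k` of `Ω'_δ` are the single axis sites
  `(m, 0)`: a BARE CORRIDOR of `4k` sites; `fat_low_mem` — the two rows `-1, -2` below the
  corridor belong to `Ω_δ` (and not to `Ω'_δ`); `cusp_axis_mem`, `fat_axis_mem`,
  `cusp_mesh_subset_fat`;
* `cusp_forced_run` — every self-avoiding walk of `Ω'_δ` from `a_δ = (1, 0)` to a far axis site
  `(B, 0)`, `B ≥ 4k + 1`, begins with the bare run `(1,0), (2,0), …, (4k, 0)`.

Def-free helper; everything proved, standard axioms. [folklore]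
-/

noncomputable section

namespace Summit.CriticalPhenomena.SAWScalingLimit.Theorems.ConfinementPositivity.Negative

open Set Metric Filter Topology Complex MeasureTheory
open scoped ENNReal
open Literature.Probability.RandomPlanarGeometry Literature.Probability.LatticeModels
open Summit.CriticalPhenomena.SAWScalingLimit.Theorems.ShellCrossingBound.Negative.Forcing
  (meshPoint_vec vec_add_single_zero vec_add_single_one eq_vec)

/-! ### Sign and monotonicity data of the two graph strips -/

/-- `hi x = x²/16` does not decrease on `[0, 1]`. [folklore] -/
theorem monotoneOn_sq_div : MonotoneOn (fun x : ℝ => x ^ 2 / 16) (Icc 0 1) :=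
  fun a ha b _ hab => by show a ^ 2 / 16 ≤ b ^ 2 / 16; nlinarith [ha.1]

/-- `lo x = -x²/16` does not increase on `[0, 1]`. [folklore] -/
theorem antitoneOn_neg_sq_div : AntitoneOn (fun x : ℝ => -(x ^ 2 / 16)) (Icc 0 1) :=
  fun a ha b _ hab => by show -(b ^ 2 / 16) ≤ -(a ^ 2 / 16); nlinarith [ha.1]

/-- The constant `lo = -1` does not increase. [folklore] -/
theorem antitoneOn_const_neg_one : AntitoneOn (fun _ : ℝ => (-1 : ℝ)) (Icc 0 1) :=
  fun _ _ _ _ _ => le_rfl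

/-- Signs for the cusp: `-x²/16 < 0 < x²/16` on `(0, 1)`. [folklore] -/
theorem cusp_sign : ∀ x : ℝ, 0 < x → x < 1 → -(x ^ 2 / 16) < 0 ∧ 0 < x ^ 2 / 16 :=
  fun x hx _ => ⟨by nlinarith [sq_pos_of_pos hx], by positivity⟩

/-- Signs for the fat region: `-1 < 0 < x²/16` on `(0, 1)`. [folklore] -/
theorem fat_sign : ∀ x : ℝ, 0 < x → x < 1 → (-1 : ℝ) < 0 ∧ 0 < x ^ 2 / 16 :=
  fun _ _ _ => ⟨by norm_num, by positivity⟩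

/-! ### Membership at the meshes `δ = 1/k²` in integer arithmetic -/

/-- Clearing denominators in the upper strip inequality. [folklore] -/
theorem aux_hi_iff {K : ℝ} (hK : 0 < K) (m n : ℝ) :
    K⁻¹ * n < (K⁻¹ * m) ^ 2 / 16 ↔ 16 * K * n < m ^ 2 := by
  have hK0 : K ≠ 0 := hK.ne'
  have h1 : (K⁻¹ * m) ^ 2 / 16 = m ^ 2 / (16 * K ^ 2) := by
    rw [div_eq_div_iff (by norm_num) (by positivity),
      show (K⁻¹ * m) ^ 2 * (16 * K ^ 2) = m ^ 2 * 16 * (K⁻¹ * K) ^ 2 by ring,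
      inv_mul_cancel₀ hK0, one_pow, mul_one]
  have h2 : K⁻¹ * n = (16 * K * n) / (16 * K ^ 2) := by
    rw [eq_div_iff (by positivity), show K⁻¹ * n * (16 * K ^ 2) = 16 * K * n * (K⁻¹ * K) by ring,
      inv_mul_cancel₀ hK0, mul_one]
  rw [h1, h2, div_lt_div_iff_of_pos_right (by positivity)]

/-- Clearing denominators in the lower cusp inequality. [folklore] -/
theorem aux_lo_iff {K : ℝ} (hK : 0 < K) (m n : ℝ) :
    -((K⁻¹ * m) ^ 2 / 16) < K⁻¹ * n ↔ -(m ^ 2) < 16 * K * n := by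
  have hK0 : K ≠ 0 := hK.ne'
  have h1 : (K⁻¹ * m) ^ 2 / 16 = m ^ 2 / (16 * K ^ 2) := by
    rw [div_eq_div_iff (by norm_num) (by positivity),
      show (K⁻¹ * m) ^ 2 * (16 * K ^ 2) = m ^ 2 * 16 * (K⁻¹ * K) ^ 2 by ring,
      inv_mul_cancel₀ hK0, one_pow, mul_one]
  have h2 : K⁻¹ * n = (16 * K * n) / (16 * K ^ 2) := by
    rw [eq_div_iff (by positivity), show K⁻¹ * n * (16 * K ^ 2) = 16 * K * n * (K⁻¹ * K) by ring,
      inv_mul_cancel₀ hK0, mul_one]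
  rw [h1, h2, ← neg_div, div_lt_div_iff_of_pos_right (by positivity)]

/-- Clearing denominators in the abscissa inequalities. [folklore] -/
theorem aux_re_iff {K : ℝ} (hK : 0 < K) (m : ℝ) :
    (0 < K⁻¹ * m ∧ K⁻¹ * m < 1) ↔ (0 < m ∧ m < K) := by
  rw [inv_mul_eq_div, div_pos_iff_of_pos_right hK, div_lt_one hK]

/-- **Cusp membership in integers**: at `δ = 1/k²`, `(m, n) ∈ Ω'_δ` iff `0 < m < k²` and
`-m² < 16 k² n < m²`. [folklore] -/
theorem cusp_vec_mem_iff {Ωc : Set ℂ}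
    (hC : ∀ z : ℂ, z ∈ Ωc ↔ 0 < z.re ∧ z.re < 1 ∧ -(z.re ^ 2 / 16) < z.im ∧ z.im < z.re ^ 2 / 16)
    {k : ℕ} (hk : 1 ≤ k) (m n : ℤ) :
    (![m, n] : Site 2) ∈ meshVertices Ωc (((k : ℝ) ^ 2)⁻¹) ↔
      0 < m ∧ m < (k : ℤ) ^ 2 ∧ -(m ^ 2) < 16 * (k : ℤ) ^ 2 * n ∧ 16 * (k : ℤ) ^ 2 * n < m ^ 2 := by
  have hK : (0 : ℝ) < (k : ℝ) ^ 2 := by positivity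
  rw [strip_vec_mem_iff (lo := fun x : ℝ => -(x ^ 2 / 16)) (hi := fun x : ℝ => x ^ 2 / 16) hC,
    ← and_assoc, aux_re_iff hK]
  show (0 < (m : ℝ) ∧ (m : ℝ) < (k : ℝ) ^ 2) ∧
      -((((k : ℝ) ^ 2)⁻¹ * m) ^ 2 / 16) < ((k : ℝ) ^ 2)⁻¹ * n ∧
        ((k : ℝ) ^ 2)⁻¹ * n < (((k : ℝ) ^ 2)⁻¹ * m) ^ 2 / 16 ↔ _
  rw [aux_lo_iff hK, aux_hi_iff hK]
  constructor
  · rintro ⟨⟨h1, h2⟩, h3, h4⟩; exact ⟨by exact_mod_cast h1, by exact_mod_cast h2,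
      by exact_mod_cast h3, by exact_mod_cast h4⟩
  · rintro ⟨h1, h2, h3, h4⟩; exact ⟨⟨by exact_mod_cast h1, by exact_mod_cast h2⟩,
      by exact_mod_cast h3, by exact_mod_cast h4⟩

/-- **Fat membership in integers**: at `δ = 1/k²`, `(m, n) ∈ Ω_δ` iff `0 < m < k²`, `-k² < n` and
`16 k² n < m²`. [folklore] -/
theorem fat_vec_mem_iff {Ωf : Set ℂ}
    (hF : ∀ z : ℂ, z ∈ Ωf ↔ 0 < z.re ∧ z.re < 1 ∧ -1 < z.im ∧ z.im < z.re ^ 2 / 16)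
    {k : ℕ} (hk : 1 ≤ k) (m n : ℤ) :
    (![m, n] : Site 2) ∈ meshVertices Ωf (((k : ℝ) ^ 2)⁻¹) ↔
      0 < m ∧ m < (k : ℤ) ^ 2 ∧ -(k : ℤ) ^ 2 < n ∧ 16 * (k : ℤ) ^ 2 * n < m ^ 2 := by
  have hK : (0 : ℝ) < (k : ℝ) ^ 2 := by positivity
  rw [strip_vec_mem_iff (lo := fun _ : ℝ => (-1 : ℝ)) (hi := fun x : ℝ => x ^ 2 / 16) hF,
    ← and_assoc, aux_re_iff hK]
  show (0 < (m : ℝ) ∧ (m : ℝ) < (k : ℝ) ^ 2) ∧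
      (-1 : ℝ) < ((k : ℝ) ^ 2)⁻¹ * n ∧ ((k : ℝ) ^ 2)⁻¹ * n < (((k : ℝ) ^ 2)⁻¹ * m) ^ 2 / 16 ↔ _
  have h3 : ((-1 : ℝ) < ((k : ℝ) ^ 2)⁻¹ * n) ↔ (-(k : ℝ) ^ 2 < n) := by
    rw [inv_mul_eq_div, lt_div_iff₀ hK]; constructor <;> intro h <;> linarith
  rw [h3, aux_hi_iff hK]
  constructor
  · rintro ⟨⟨h1, h2⟩, h3, h4⟩; exact ⟨by exact_mod_cast h1, by exact_mod_cast h2,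
      by exact_mod_cast h3, by exact_mod_cast h4⟩
  · rintro ⟨h1, h2, h3, h4⟩; exact ⟨⟨by exact_mod_cast h1, by exact_mod_cast h2⟩,
      by exact_mod_cast h3, by exact_mod_cast h4⟩

/-- **The bare corridor**: at `δ = 1/k²` the columns `1 ≤ m ≤ 4k` of the cusp carry only the
axis sites `(m, 0)` (`16 k² |n| ≥ 16 k² ≥ m²` for `n ≠ 0`). [folklore] -/
theorem cusp_offaxis_not_mem {Ωc : Set ℂ}
    (hC : ∀ z : ℂ, z ∈ Ωc ↔ 0 < z.re ∧ z.re < 1 ∧ -(z.re ^ 2 / 16) < z.im ∧ z.im < z.re ^ 2 / 16)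
    {k : ℕ} (hk : 1 ≤ k) {m n : ℤ} (hm1 : 1 ≤ m) (hm : m ≤ 4 * k) (hn : n ≠ 0) :
    (![m, n] : Site 2) ∉ meshVertices Ωc (((k : ℝ) ^ 2)⁻¹) := by
  rw [cusp_vec_mem_iff hC hk]
  rintro ⟨-, -, h3, h4⟩
  have hm2 : m ^ 2 ≤ 16 * (k : ℤ) ^ 2 := by nlinarith
  rcases lt_or_gt_of_ne hn with hneg | hpos
  · have : n ≤ -1 := by omega
    nlinarith
  · have : 1 ≤ n := by omega
    nlinarith

/-- The rows `-1, -2` below the corridor (columns `1 ≤ m ≤ 4k`) lie in the fat region at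
`δ = 1/k²`, `k ≥ 5`. [folklore] -/
theorem fat_low_mem {Ωf : Set ℂ}
    (hF : ∀ z : ℂ, z ∈ Ωf ↔ 0 < z.re ∧ z.re < 1 ∧ -1 < z.im ∧ z.im < z.re ^ 2 / 16)
    {k : ℕ} (hk : 5 ≤ k) {m n : ℤ} (hm1 : 1 ≤ m) (hm : m ≤ 4 * k) (hn : n = -1 ∨ n = -2) :
    (![m, n] : Site 2) ∈ meshVertices Ωf (((k : ℝ) ^ 2)⁻¹) := by
  rw [fat_vec_mem_iff hF (by omega)]
  have hk' : (5 : ℤ) ≤ k := by exact_mod_cast hk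
  refine ⟨by omega, by nlinarith, ?_, ?_⟩ <;> rcases hn with rfl | rfl <;> nlinarith

/-- Axis sites `(m, 0)`, `1 ≤ m < k²`, lie in the cusp at `δ = 1/k²`. [folklore] -/
theorem cusp_axis_mem {Ωc : Set ℂ}
    (hC : ∀ z : ℂ, z ∈ Ωc ↔ 0 < z.re ∧ z.re < 1 ∧ -(z.re ^ 2 / 16) < z.im ∧ z.im < z.re ^ 2 / 16)
    {k : ℕ} (hk : 1 ≤ k) {m : ℤ} (hm1 : 1 ≤ m) (hm : m < (k : ℤ) ^ 2) :
    (![m, 0] : Site 2) ∈ meshVertices Ωc (((k : ℝ) ^ 2)⁻¹) := by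
  rw [cusp_vec_mem_iff hC hk]
  refine ⟨by omega, hm, ?_, ?_⟩ <;> nlinarith

/-- Axis sites `(m, 0)`, `1 ≤ m < k²`, lie in the fat region at `δ = 1/k²`. [folklore] -/
theorem fat_axis_mem {Ωf : Set ℂ}
    (hF : ∀ z : ℂ, z ∈ Ωf ↔ 0 < z.re ∧ z.re < 1 ∧ -1 < z.im ∧ z.im < z.re ^ 2 / 16)
    {k : ℕ} (hk : 1 ≤ k) {m : ℤ} (hm1 : 1 ≤ m) (hm : m < (k : ℤ) ^ 2) :
    (![m, 0] : Site 2) ∈ meshVertices Ωf (((k : ℝ) ^ 2)⁻¹) := by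
  rw [fat_vec_mem_iff hF hk]
  have : (1 : ℤ) ≤ k := by exact_mod_cast hk
  refine ⟨by omega, hm, by nlinarith, by nlinarith⟩

/-- The cusp lies in the fat region (lattice form at `δ = 1/k²`). [folklore] -/
theorem cusp_mesh_subset_fat {Ωc Ωf : Set ℂ}
    (hC : ∀ z : ℂ, z ∈ Ωc ↔ 0 < z.re ∧ z.re < 1 ∧ -(z.re ^ 2 / 16) < z.im ∧ z.im < z.re ^ 2 / 16)
    (hF : ∀ z : ℂ, z ∈ Ωf ↔ 0 < z.re ∧ z.re < 1 ∧ -1 < z.im ∧ z.im < z.re ^ 2 / 16) (δ : ℝ) :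
    meshVertices Ωc δ ⊆ meshVertices Ωf δ := by
  intro x hx
  rw [mem_meshVertices_iff, hC] at hx
  rw [mem_meshVertices_iff, hF]
  obtain ⟨h1, h2, h3, h4⟩ := hx
  refine ⟨h1, h2, ?_, h4⟩
  have : (meshPoint δ x).re ^ 2 < 1 := by nlinarith
  linarith

/-! ### The forced run along the bare corridor -/

/-- **Forced run.** At `δ = 1/k²`, every self-avoiding walk of the cusp `Ω'_δ` from `a_δ = (1,0)`
to an axis site `(B, 0)` beyond the corridor (`B ≥ 4k + 1`) passes, in order, through
`(1,0), (2,0), …, (4k, 0)`: inside the bare corridor the only fresh neighbour of `(m, 0)` is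
`(m+1, 0)` (`(m, ±1) ∉ Ω'_δ`, `(0,0) ∉ Ω'_δ`, `(m-1, 0)` already visited). [folklore] -/
theorem cusp_forced_run {Ωc : Set ℂ}
    (hC : ∀ z : ℂ, z ∈ Ωc ↔ 0 < z.re ∧ z.re < 1 ∧ -(z.re ^ 2 / 16) < z.im ∧ z.im < z.re ^ 2 / 16)
    {k : ℕ} (hk : 1 ≤ k) {B : ℤ} (hB : 4 * (k : ℤ) + 1 ≤ B)
    (γ : (discreteDomainGraph Ωc (((k : ℝ) ^ 2)⁻¹)).Walk ![1, 0] ![B, 0]) (hγ : γ.IsPath) :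
    ∀ i : ℕ, i + 1 ≤ 4 * k → γ.getVert i = ![(i : ℤ) + 1, 0] := by
  suffices H : ∀ i : ℕ, i + 1 ≤ 4 * k → ∀ j ≤ i, γ.getVert j = ![(j : ℤ) + 1, 0] from
    fun i hi => H i hi i le_rfl
  intro i
  induction i with
  | zero =>
    intro _ j hj
    obtain rfl : j = 0 := Nat.le_zero.1 hj
    rw [SimpleGraph.Walk.getVert_zero]
    simp
  | succ i ih =>
    intro hi j hj
    rcases Nat.lt_or_ge j (i + 1) with hlt | hge
    · exact ih (by omega) j (by omega)
    obtain rfl : j = i + 1 := le_antisymm hj hge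
    have hvi : γ.getVert i = ![(i : ℤ) + 1, 0] := ih (by omega) i le_rfl
    -- the walk is not over at step `i`
    have hlen : i < γ.length := by
      by_contra hle
      push Not at hle
      have h1 := γ.getVert_of_length_le hle
      rw [hvi] at h1
      have h2 := congrFun h1 0
      simp only [Matrix.cons_val_zero] at h2
      omega
    have hadj := γ.adj_getVert_succ hlen
    rw [hvi] at hadj
    obtain ⟨hmesh, -, hwD⟩ := discreteDomainGraph_adj_iff.1 hadj
    have hw : γ.getVert (i + 1) ∈ meshVertices Ωc (((k : ℝ) ^ 2)⁻¹) :=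
      meshDomain_subset_meshVertices _ _ hwD
    have hzd := meshGraph_le_zdGraph _ _ hmesh
    obtain ⟨c, hc | hc⟩ := (zdGraph_adj_iff _ _).1 hzd
    · -- `w = v + e_c`
      have hc2 : c = 0 ∨ c = 1 := by fin_cases c <;> simp
      rcases hc2 with rfl | rfl
      · have e : (i : ℤ) + 1 + 1 = ((i + 1 : ℕ) : ℤ) + 1 := by omega
        rw [hc, vec_add_single_zero, e]
      · exfalso
        rw [hc, vec_add_single_one] at hw
        exact cusp_offaxis_not_mem hC hk (m := (i : ℤ) + 1) (n := 0 + 1) (by omega) (by omega)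
          (by norm_num) hw
    · -- `v = w + e_c`, i.e. `w = v - e_c`
      have h0 := congrFun hc 0
      have h1 := congrFun hc 1
      have hc2 : c = 0 ∨ c = 1 := by fin_cases c <;> simp
      rcases hc2 with rfl | rfl
      · simp only [Matrix.cons_val_zero, Matrix.cons_val_one, Matrix.cons_val_fin_one, Pi.add_apply,
          Pi.single_eq_same, ne_eq, one_ne_zero, not_false_eq_true, Pi.single_eq_of_ne,
          add_zero] at h0 h1
        -- `w = (i, 0)`
        have hw' : γ.getVert (i + 1) = ![(i : ℤ), 0] := by
          rw [eq_vec (γ.getVert (i + 1))]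
          have e0 : γ.getVert (i + 1) 0 = i := by omega
          have e1 : γ.getVert (i + 1) 1 = 0 := by omega
          rw [e0, e1]
        exfalso
        rcases Nat.eq_zero_or_pos i with rfl | hipos
        · -- `(0, 0)` is not a vertex of the cusp
          rw [hw'] at hw
          have := (cusp_vec_mem_iff hC hk 0 0).1 (by exact_mod_cast hw)
          omega
        · -- `(i, 0)` was visited two steps earlier
          obtain ⟨i', rfl⟩ : ∃ i', i = i' + 1 := ⟨i - 1, by omega⟩
          have hprev : γ.getVert i' = ![(i' : ℤ) + 1, 0] := ih (by omega) i' (by omega)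
          have heq : γ.getVert (i' + 1 + 1) = γ.getVert i' := by
            have e : ((i' + 1 : ℕ) : ℤ) = (i' : ℤ) + 1 := by omega
            rw [hw', hprev, e]
          have := hγ.getVert_injOn (by simp only [Set.mem_setOf_eq]; omega)
            (by simp only [Set.mem_setOf_eq]; omega) heq
          omega
      · simp only [Matrix.cons_val_zero, Matrix.cons_val_one, Matrix.cons_val_fin_one, Pi.add_apply,
          Pi.single_eq_same, ne_eq, zero_ne_one, not_false_eq_true, Pi.single_eq_of_ne,
          add_zero] at h0 h1
        have hw' : γ.getVert (i + 1) = ![(i : ℤ) + 1, -1] := by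
          rw [eq_vec (γ.getVert (i + 1))]
          have e0 : γ.getVert (i + 1) 0 = i + 1 := by omega
          have e1 : γ.getVert (i + 1) 1 = -1 := by omega
          rw [e0, e1]
        exfalso
        rw [hw'] at hw
        exact cusp_offaxis_not_mem hC hk (m := (i : ℤ) + 1) (n := -1) (by omega) (by omega)
          (by norm_num) hw

end Summit.CriticalPhenomena.SAWScalingLimit.Theorems.ConfinementPositivity.Negative

end
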